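import Literature.Analysis.FluidPDE.TwoHalfNavierStokes
import Literature.Analysis.FluidPDE.DEIJShearStage
import HarnessLib

/-!
# Sheet-dodger fields: planar shear data `V = (−c S(y₁), 0)`, `R = S(y₁) G(y₀)` on `T²` and the
# `2½`-dimensional field `(V, R) ∘ π` on `T³` (negative knowledge for crux stmt-AnomalousDissipation-13038)

For two smooth `1`-periodic profiles `S, G` (`Torus.ShearProfile`) and `c ∈ ℝ` the planar data
`V(y) = (−c S(y₁)) e₀`, `R(y) = S(y₁) G(y₀)` are smooth, `V` is divergence free with `(V·∇)V = 0`, and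
`V·∇R = −c S(y₁)² G'(y₀)`; hence `u = (V, R) ∘ π` is smooth, divergence free, with
`(u·∇)u = (0, 0, −c S² G') ∘ π` (`Torus.convect_twoHalf`). When `S` is odd under the half-period shift,
`u` has zero mean. Energy and enstrophy of `u` are expressed through one-dimensional period integrals of
`S, S', G, G'`. With `G = cos(2πk·)/(2πkc)` this is the explicit vortex-sheet dodger family for the
Kolmogorov-mode force `sin(2πk x₀) e₂` (file `SheetDodgerKolmogorov`). Pure proofs, no definitions.
-/

noncomputable section

open Set Filter MeasureTheory intervalIntegral Function
open scoped Topology Real ContDiff InnerProductSpace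

-- `Summit.<Summit>.<Problem>` is the tree's mandated summit-side namespace (CONVENTIONS §2); single-conjunct summit, duplicate deliberate.
set_option linter.dupNamespace false

namespace Summit.AnomalousDissipation.AnomalousDissipation.Theorems.SteadyStatesLoudBounded.SheetDodger

open Literature.Analysis.FunctionSpaces Literature.Analysis.FunctionSpaces.Torus
open Literature.Analysis.FluidPDE.Torus.DEIJ (isSmooth_onCircle_comp)
open Literature.Analysis.FluidPDE.Torus (hasZeroMean_twoHalf integral_norm_sq_twoHalf gradNormSq_twoHalf)

/-! ## Calculus of a profile read on one coordinate of `T^d` -/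

section Coord

variable {d : Type*} [Fintype d] [DecidableEq d]

omit [Fintype d] in
/-- Translating `x` by `proj (t eᵢ)` adds `t` to the `i`-th coordinate and fixes the others. -/
theorem add_proj_smul_single_apply (x : UnitAddTorus d) (t : ℝ) (i q : d) :
    (x + proj (t • EuclideanSpace.single i (1 : ℝ))) q = x q + (((if q = i then t else 0 : ℝ)) : UnitAddCircle) := by
  simp only [Pi.add_apply, proj_apply, PiLp.smul_apply, EuclideanSpace.single, PiLp.single_apply, smul_eq_mul,
    mul_ite, mul_one, mul_zero]

omit [Fintype d] in
/-- **Partial derivatives of a coordinate profile**: `∂ᵢ (x ↦ S(x_q)) = δ_{iq} S'(x_q)`. -/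
theorem partialDeriv_onCircle_comp (S : ShearProfile) (i q : d) (x : UnitAddTorus d) :
    partialDeriv i (fun y : UnitAddTorus d => S.onCircle (y q)) x =
      if i = q then S.D.onCircle (x q) else 0 := by
  unfold partialDeriv Torus.lineDeriv
  simp_rw [add_proj_smul_single_apply]
  induction x q using QuotientAddGroup.induction_on with
  | H s =>
    have e : (fun t : ℝ => S.onCircle ((s : UnitAddCircle) + (((if q = i then t else 0 : ℝ)) : UnitAddCircle))) =
        fun t : ℝ => S (s + (if q = i then t else 0)) := by
      funext t
      rw [← AddCircle.coe_add, ShearProfile.onCircle_coe]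
    change deriv (fun t : ℝ => S.onCircle ((s : UnitAddCircle) + (((if q = i then t else 0 : ℝ)) : UnitAddCircle))) 0 = _
    rw [e]
    by_cases hi : i = q
    · subst hi
      simp only [if_true]
      rw [ShearProfile.onCircle_coe, ShearProfile.D_apply]
      have h : HasDerivAt (fun t : ℝ => S (s + t)) (deriv S (s + 0)) 0 :=
        HasDerivAt.comp_const_add s 0 ((S.contDiff.differentiable (by simp)).differentiableAt.hasDerivAt)
      rw [h.deriv, add_zero]
    · have hq : ¬ q = i := fun h => hi h.symm
      simp only [hq, if_false, hi, add_zero, deriv_const]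

end Coord


/-! ## Integrals over `T^d` of a profile read on one coordinate -/

section CoordIntegral

variable {d : Type*} [Fintype d] [DecidableEq d]

omit [DecidableEq d] in
/-- **One-coordinate integrals**: `∫_{T^d} F(S(x_q)) dx = ∫₀¹ F ∘ S` for continuous `F` (the coordinate map is measure
preserving onto the circle, and the circle integral is a period integral). -/
theorem integral_onCircle_comp (S : ShearProfile) {F : ℝ → ℝ} (hF : Continuous F) (q : d) :
    ∫ x : UnitAddTorus d, F (S.onCircle (x q)) = ∫ t in (0 : ℝ)..1, F (S t) := by
  have hmp : MeasurePreserving (Function.eval q) (volume : Measure (UnitAddTorus d)) (volume : Measure UnitAddCircle) :=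
    measurePreserving_eval (μ := fun _ : d => (volume : Measure UnitAddCircle)) q
  have h1 : ∫ x : UnitAddTorus d, F (S.onCircle (x q)) = ∫ b : UnitAddCircle, F (S.onCircle b) := by
    rw [← hmp.map_eq, integral_map (measurable_pi_apply q).aemeasurable
      (hF.comp S.continuous_onCircle).aestronglyMeasurable]
  rw [h1, ← UnitAddCircle.intervalIntegral_preimage 0 (fun b => F (S.onCircle b)), zero_add]
  exact intervalIntegral.integral_congr fun t _ => by simp only [ShearProfile.onCircle_coe]

end CoordIntegral

/-! ## Planar data on `T²`: `V = S(y₁) • (−c e₀)`, `R = S(y₁) G(y₀)` -/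

section Planar

variable (S G : ShearProfile) (c : ℝ)

/-- `V` is smooth. -/
theorem isSmooth_V : Torus.IsSmooth (fun y : UnitAddTorus (Fin 2) =>
    S.onCircle (y 1) • ((-c) • EuclideanSpace.single (0 : Fin 2) (1 : ℝ))) :=
  (isSmooth_onCircle_comp 1 S).smul' (isSmooth_const _)

/-- `R` is smooth. -/
theorem isSmooth_R : Torus.IsSmooth (fun y : UnitAddTorus (Fin 2) => S.onCircle (y 1) * G.onCircle (y 0)) :=
  ContDiff.mul (isSmooth_onCircle_comp 1 S) (isSmooth_onCircle_comp 0 G)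

/-- Partial derivatives of `V`: `∂ᵢV = δ_{i1} S'(y₁) • (−c e₀)`. -/
theorem partialDeriv_V (i : Fin 2) (y : UnitAddTorus (Fin 2)) :
    Torus.partialDeriv i (fun y : UnitAddTorus (Fin 2) =>
        S.onCircle (y 1) • ((-c) • EuclideanSpace.single (0 : Fin 2) (1 : ℝ))) y =
      (if i = 1 then S.D.onCircle (y 1) else 0) • ((-c) • EuclideanSpace.single (0 : Fin 2) (1 : ℝ)) := by
  have hS1 : Torus.IsContDiff 1 (fun y : UnitAddTorus (Fin 2) => S.onCircle (y 1)) :=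
    (isSmooth_onCircle_comp 1 S).isContDiff (by simp)
  rw [partialDeriv_smul hS1 ((isSmooth_const _).isContDiff (by simp)), partialDeriv_onCircle_comp]
  have h0 : Torus.partialDeriv i (fun _ : UnitAddTorus (Fin 2) => (-c) • EuclideanSpace.single (0 : Fin 2) (1 : ℝ)) y = 0 := by
    unfold Torus.partialDeriv Torus.lineDeriv
    exact deriv_const _ _
  rw [h0, smul_zero, zero_add]

/-- Partial derivatives of `R`: `∂ᵢR = S(y₁) δ_{i0} G'(y₀) + δ_{i1} S'(y₁) G(y₀)`. -/
theorem partialDeriv_R (i : Fin 2) (y : UnitAddTorus (Fin 2)) :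
    Torus.partialDeriv i (fun y : UnitAddTorus (Fin 2) => S.onCircle (y 1) * G.onCircle (y 0)) y =
      S.onCircle (y 1) * (if i = 0 then G.D.onCircle (y 0) else 0) +
        (if i = 1 then S.D.onCircle (y 1) else 0) * G.onCircle (y 0) := by
  have hS1 : Torus.IsContDiff 1 (fun y : UnitAddTorus (Fin 2) => S.onCircle (y 1)) :=
    (isSmooth_onCircle_comp 1 S).isContDiff (by simp)
  have hG1 : Torus.IsContDiff 1 (fun y : UnitAddTorus (Fin 2) => G.onCircle (y 0)) :=
    (isSmooth_onCircle_comp 0 G).isContDiff (by simp)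
  rw [partialDeriv_mul hS1 hG1, partialDeriv_onCircle_comp, partialDeriv_onCircle_comp]

/-- `V` is divergence free (its only nonzero component, the `0`-th, does not depend on `y₀`). -/
theorem isDivFree_V : Torus.IsDivFree (fun y : UnitAddTorus (Fin 2) =>
    S.onCircle (y 1) • ((-c) • EuclideanSpace.single (0 : Fin 2) (1 : ℝ))) := by
  intro y
  unfold Torus.divergence
  rw [Fin.sum_univ_two]
  have h0 : (fun y : UnitAddTorus (Fin 2) => (S.onCircle (y 1) • ((-c) • EuclideanSpace.single (0 : Fin 2) (1 : ℝ))) 0) =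
      fun y => S.onCircle (y 1) * (-c) := by
    funext y; simp
  have h1 : (fun y : UnitAddTorus (Fin 2) => (S.onCircle (y 1) • ((-c) • EuclideanSpace.single (0 : Fin 2) (1 : ℝ))) 1) =
      fun _ => (0 : ℝ) := by
    funext y; simp
  rw [h0, h1]
  have hS1 : Torus.IsContDiff 1 (fun y : UnitAddTorus (Fin 2) => S.onCircle (y 1)) :=
    (isSmooth_onCircle_comp 1 S).isContDiff (by simp)
  rw [partialDeriv_mul hS1 ((isSmooth_const _).isContDiff (by simp)), partialDeriv_onCircle_comp]
  have hc : Torus.partialDeriv 0 (fun _ : UnitAddTorus (Fin 2) => -c) y = 0 := by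
    unfold Torus.partialDeriv Torus.lineDeriv; exact deriv_const _ _
  have hz : Torus.partialDeriv 1 (fun _ : UnitAddTorus (Fin 2) => (0 : ℝ)) y = 0 := by
    unfold Torus.partialDeriv Torus.lineDeriv; exact deriv_const _ _
  rw [hc, hz]
  simp

/-- `(V·∇)V = 0` (`V` is parallel to `e₀` and does not depend on `y₀`). -/
theorem convect_V (y : UnitAddTorus (Fin 2)) :
    Torus.convect (fun y : UnitAddTorus (Fin 2) => S.onCircle (y 1) • ((-c) • EuclideanSpace.single (0 : Fin 2) (1 : ℝ)))
      (fun y : UnitAddTorus (Fin 2) => S.onCircle (y 1) • ((-c) • EuclideanSpace.single (0 : Fin 2) (1 : ℝ))) y = 0 := by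
  have hV1 : Torus.IsContDiff 1 (fun y : UnitAddTorus (Fin 2) =>
      S.onCircle (y 1) • ((-c) • EuclideanSpace.single (0 : Fin 2) (1 : ℝ))) := (isSmooth_V S c).isContDiff (by simp)
  unfold Torus.convect
  rw [fderiv_apply_eq_sum_partialDeriv hV1, Fin.sum_univ_two, partialDeriv_V, partialDeriv_V]
  simp

/-- `V·∇R = −c S(y₁)² G'(y₀)`. -/
theorem inner_V_gradient_R (y : UnitAddTorus (Fin 2)) :
    ⟪(fun y : UnitAddTorus (Fin 2) => S.onCircle (y 1) • ((-c) • EuclideanSpace.single (0 : Fin 2) (1 : ℝ))) y,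
      Torus.gradient (fun y : UnitAddTorus (Fin 2) => S.onCircle (y 1) * G.onCircle (y 0)) y⟫_ℝ =
      -c * S.onCircle (y 1) ^ 2 * G.D.onCircle (y 0) := by
  have hR1 : Torus.IsContDiff 1 (fun y : UnitAddTorus (Fin 2) => S.onCircle (y 1) * G.onCircle (y 0)) :=
    (isSmooth_R S G).isContDiff (by simp)
  rw [real_inner_comm, Torus.inner_gradient_left, fderiv_apply_eq_sum_partialDeriv hR1, Fin.sum_univ_two,
    partialDeriv_R, partialDeriv_R]
  simp
  ring

/-! ## The `2½`-dimensional field `u = (V, R) ∘ π` on `T³` -/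

/-- `u` is smooth. -/
theorem isSmooth_u : Torus.IsSmooth (twoHalf
    (fun y : UnitAddTorus (Fin 2) => S.onCircle (y 1) • ((-c) • EuclideanSpace.single (0 : Fin 2) (1 : ℝ)))
    (fun y : UnitAddTorus (Fin 2) => S.onCircle (y 1) * G.onCircle (y 0))) :=
  (isSmooth_V S c).twoHalf (isSmooth_R S G)

/-- `u` is divergence free. -/
theorem isDivFree_u : Torus.IsDivFree (twoHalf
    (fun y : UnitAddTorus (Fin 2) => S.onCircle (y 1) • ((-c) • EuclideanSpace.single (0 : Fin 2) (1 : ℝ)))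
    (fun y : UnitAddTorus (Fin 2) => S.onCircle (y 1) * G.onCircle (y 0))) :=
  (isDivFree_V S c).twoHalf _

/-- **The convective term of `u`**: `(u·∇)u = (0, 0, −c S(y₁)² G'(y₀)) ∘ π`. -/
theorem convect_u :
    Torus.convect (twoHalf
        (fun y : UnitAddTorus (Fin 2) => S.onCircle (y 1) • ((-c) • EuclideanSpace.single (0 : Fin 2) (1 : ℝ)))
        (fun y : UnitAddTorus (Fin 2) => S.onCircle (y 1) * G.onCircle (y 0)))
      (twoHalf
        (fun y : UnitAddTorus (Fin 2) => S.onCircle (y 1) • ((-c) • EuclideanSpace.single (0 : Fin 2) (1 : ℝ)))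
        (fun y : UnitAddTorus (Fin 2) => S.onCircle (y 1) * G.onCircle (y 0))) =
      twoHalf 0 (fun y : UnitAddTorus (Fin 2) => -c * S.onCircle (y 1) ^ 2 * G.D.onCircle (y 0)) := by
  rw [convect_twoHalf ((isSmooth_V S c).isContDiff (by simp)) ((isSmooth_R S G).isContDiff (by simp))]
  have h1 : Torus.convect
      (fun y : UnitAddTorus (Fin 2) => S.onCircle (y 1) • ((-c) • EuclideanSpace.single (0 : Fin 2) (1 : ℝ)))
      (fun y : UnitAddTorus (Fin 2) => S.onCircle (y 1) • ((-c) • EuclideanSpace.single (0 : Fin 2) (1 : ℝ))) = 0 := by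
    funext y; exact convect_V S c y
  have h2 : (fun y : UnitAddTorus (Fin 2) =>
      ⟪(fun y : UnitAddTorus (Fin 2) => S.onCircle (y 1) • ((-c) • EuclideanSpace.single (0 : Fin 2) (1 : ℝ))) y,
        Torus.gradient (fun y : UnitAddTorus (Fin 2) => S.onCircle (y 1) * G.onCircle (y 0)) y⟫_ℝ) =
      fun y => -c * S.onCircle (y 1) ^ 2 * G.D.onCircle (y 0) := by
    funext y; exact inner_V_gradient_R S G c y
  rw [h1, h2]

/-- **Zero mean** when `S` is odd under the half-period shift: `∫_{T³} u = 0`. -/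
theorem hasZeroMean_u (hS : ∀ t, S (t + 2⁻¹) = -S t) : Torus.HasZeroMean (twoHalf
    (fun y : UnitAddTorus (Fin 2) => S.onCircle (y 1) • ((-c) • EuclideanSpace.single (0 : Fin 2) (1 : ℝ)))
    (fun y : UnitAddTorus (Fin 2) => S.onCircle (y 1) * G.onCircle (y 0))) := by
  -- the half-period shift in `y₁`
  set w : UnitAddTorus (Fin 2) := fun i => if i = 1 then (((2⁻¹ : ℝ)) : UnitAddCircle) else 0 with hw
  have hshift : ∀ y : UnitAddTorus (Fin 2), S.onCircle ((y + w) 1) = -S.onCircle (y 1) := by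
    intro y
    have e : (y + w) 1 = y 1 + (((2⁻¹ : ℝ)) : UnitAddCircle) := by simp [hw]
    rw [e]
    induction y 1 using QuotientAddGroup.induction_on with
    | H s => rw [← AddCircle.coe_add, S.onCircle_coe, S.onCircle_coe, hS]
  have hfix : ∀ y : UnitAddTorus (Fin 2), (y + w) 0 = y 0 := by intro y; simp [hw]
  have hVi : Integrable (fun y : UnitAddTorus (Fin 2) =>
      S.onCircle (y 1) • ((-c) • EuclideanSpace.single (0 : Fin 2) (1 : ℝ))) volume := (isSmooth_V S c).integrable
  have hRi : Integrable (fun y : UnitAddTorus (Fin 2) => S.onCircle (y 1) * G.onCircle (y 0)) volume :=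
    (isSmooth_R S G).integrable
  refine hasZeroMean_twoHalf hVi hRi ?_ ?_
  · unfold Torus.HasZeroMean
    have h := integral_add_right_eq_self (μ := (volume : Measure (UnitAddTorus (Fin 2))))
      (fun y : UnitAddTorus (Fin 2) => S.onCircle (y 1) • ((-c) • EuclideanSpace.single (0 : Fin 2) (1 : ℝ))) w
    have e : (fun x : UnitAddTorus (Fin 2) => S.onCircle ((x + w) 1) • ((-c) • EuclideanSpace.single (0 : Fin 2) (1 : ℝ))) =
        fun x => -(S.onCircle (x 1) • ((-c) • EuclideanSpace.single (0 : Fin 2) (1 : ℝ))) := by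
      funext x; rw [hshift, neg_smul]
    rw [e, MeasureTheory.integral_neg] at h
    have h2 : (2 : ℝ) • (∫ x : UnitAddTorus (Fin 2), S.onCircle (x 1) • ((-c) • EuclideanSpace.single (0 : Fin 2) (1 : ℝ))) = 0 := by
      rw [two_smul]
      nth_rewrite 1 [← h]
      exact neg_add_cancel _
    rwa [smul_eq_zero, or_iff_right (two_ne_zero)] at h2
  · unfold Torus.HasZeroMean
    have h := integral_add_right_eq_self (μ := (volume : Measure (UnitAddTorus (Fin 2))))
      (fun y : UnitAddTorus (Fin 2) => S.onCircle (y 1) * G.onCircle (y 0)) w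
    simp_rw [hshift, hfix, neg_mul, MeasureTheory.integral_neg] at h
    linarith


/-! ## Energy and enstrophy of `u` through period integrals of the profiles -/

/-- Values of a profile on the circle obey the bounds of the profile. -/
theorem abs_onCircle_le {P : ShearProfile} {M : ℝ} (hM : ∀ t, |P t| ≤ M) (b : UnitAddCircle) : |P.onCircle b| ≤ M := by
  induction b using QuotientAddGroup.induction_on with
  | H t => rw [ShearProfile.onCircle_coe]; exact hM t

/-- **Energy bound**: `∫_{T³} ‖u‖² ≤ c² + M_G²` when `|S| ≤ 1`, `|G| ≤ M_G`. -/
theorem integral_norm_sq_u_le (hS : ∀ t, |S t| ≤ 1) {MG : ℝ} (hG : ∀ t, |G t| ≤ MG) :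
    ∫ x, ‖twoHalf
        (fun y : UnitAddTorus (Fin 2) => S.onCircle (y 1) • ((-c) • EuclideanSpace.single (0 : Fin 2) (1 : ℝ)))
        (fun y : UnitAddTorus (Fin 2) => S.onCircle (y 1) * G.onCircle (y 0)) x‖ ^ 2 ≤ c ^ 2 + MG ^ 2 := by
  rw [integral_norm_sq_twoHalf (isSmooth_V S c).continuous (isSmooth_R S G).continuous]
  have hMG : 0 ≤ MG := (abs_nonneg _).trans (hG 0)
  have h1 : ∫ y : UnitAddTorus (Fin 2), ‖S.onCircle (y 1) • ((-c) • EuclideanSpace.single (0 : Fin 2) (1 : ℝ))‖ ^ 2 ≤ c ^ 2 := by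
    have hpt : ∀ y : UnitAddTorus (Fin 2), ‖S.onCircle (y 1) • ((-c) • EuclideanSpace.single (0 : Fin 2) (1 : ℝ))‖ ^ 2 ≤ c ^ 2 := by
      intro y
      rw [norm_smul, norm_smul, PiLp.norm_single, norm_one, mul_one, Real.norm_eq_abs, Real.norm_eq_abs, abs_neg, mul_pow,
        sq_abs, sq_abs]
      have hs : |S.onCircle (y 1)| ≤ 1 := abs_onCircle_le hS _
      have : S.onCircle (y 1) ^ 2 ≤ 1 := by
        have := abs_le.1 hs; nlinarith
      nlinarith [sq_nonneg c]
    calc _ ≤ ∫ _ : UnitAddTorus (Fin 2), c ^ 2 := integral_mono ((isSmooth_V S c).continuous.norm.pow 2).integrable_unitAddTorus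
          (integrable_const _) hpt
      _ = c ^ 2 := by simp
  have h2 : ∫ y : UnitAddTorus (Fin 2), (S.onCircle (y 1) * G.onCircle (y 0)) ^ 2 ≤ MG ^ 2 := by
    have hpt : ∀ y : UnitAddTorus (Fin 2), (S.onCircle (y 1) * G.onCircle (y 0)) ^ 2 ≤ MG ^ 2 := by
      intro y
      have hs := abs_le.1 (abs_onCircle_le hS (y 1))
      have hg := abs_le.1 (abs_onCircle_le hG (y 0))
      rw [mul_pow]
      have h1' : S.onCircle (y 1) ^ 2 ≤ 1 := by nlinarith
      have h2' : G.onCircle (y 0) ^ 2 ≤ MG ^ 2 := by nlinarith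
      nlinarith [sq_nonneg (S.onCircle (y 1)), sq_nonneg (G.onCircle (y 0))]
    calc _ ≤ ∫ _ : UnitAddTorus (Fin 2), MG ^ 2 := integral_mono ((isSmooth_R S G).continuous.pow 2).integrable_unitAddTorus
          (integrable_const _) hpt
      _ = MG ^ 2 := by simp
  linarith

/-- **Enstrophy of `u` through the profiles** (two-sided): with `|S| ≤ 1`, `|G| ≤ M_G`, `|G'| ≤ M_G'`,
`c² ∫₀¹ S'² ≤ gradNormSq u ≤ (c² + M_G²) ∫₀¹ S'² + M_G'²`. -/
theorem gradNormSq_u_bounds (hS : ∀ t, |S t| ≤ 1) {MG MG' : ℝ} (hG : ∀ t, |G t| ≤ MG) (hG' : ∀ t, |deriv G t| ≤ MG') :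
    c ^ 2 * ∫ t in (0 : ℝ)..1, deriv S t ^ 2 ≤ Torus.gradNormSq (twoHalf
        (fun y : UnitAddTorus (Fin 2) => S.onCircle (y 1) • ((-c) • EuclideanSpace.single (0 : Fin 2) (1 : ℝ)))
        (fun y : UnitAddTorus (Fin 2) => S.onCircle (y 1) * G.onCircle (y 0))) ∧
    Torus.gradNormSq (twoHalf
        (fun y : UnitAddTorus (Fin 2) => S.onCircle (y 1) • ((-c) • EuclideanSpace.single (0 : Fin 2) (1 : ℝ)))
        (fun y : UnitAddTorus (Fin 2) => S.onCircle (y 1) * G.onCircle (y 0))) ≤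
      (c ^ 2 + MG ^ 2) * (∫ t in (0 : ℝ)..1, deriv S t ^ 2) + MG' ^ 2 := by
  have hMG : 0 ≤ MG := (abs_nonneg _).trans (hG 0)
  rw [gradNormSq_twoHalf (isSmooth_V S c) (isSmooth_R S G)]
  -- the planar part exactly
  have hV : Torus.gradNormSq (fun y : UnitAddTorus (Fin 2) =>
      S.onCircle (y 1) • ((-c) • EuclideanSpace.single (0 : Fin 2) (1 : ℝ))) = c ^ 2 * ∫ t in (0 : ℝ)..1, deriv S t ^ 2 := by
    unfold Torus.gradNormSq
    have hpt : ∀ y : UnitAddTorus (Fin 2), ∑ i, ‖Torus.partialDeriv i (fun y : UnitAddTorus (Fin 2) =>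
        S.onCircle (y 1) • ((-c) • EuclideanSpace.single (0 : Fin 2) (1 : ℝ))) y‖ ^ 2 = c ^ 2 * (S.D.onCircle (y 1)) ^ 2 := by
      intro y
      rw [Fin.sum_univ_two, partialDeriv_V, partialDeriv_V]
      simp only [Fin.isValue, zero_ne_one, ↓reduceIte, zero_smul, norm_zero, ne_eq, OfNat.ofNat_ne_zero,
        not_false_eq_true, zero_pow, zero_add]
      rw [norm_smul, norm_smul, PiLp.norm_single, norm_one, mul_one, Real.norm_eq_abs, Real.norm_eq_abs, abs_neg, mul_pow,
        sq_abs, sq_abs]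
      ring
    simp_rw [hpt]
    rw [MeasureTheory.integral_const_mul, integral_onCircle_comp S.D (F := fun r : ℝ => r ^ 2) (continuous_pow 2) (1 : Fin 2)]
    simp [ShearProfile.D_apply]
  -- the scalar part: `0 ≤ ∫‖∇R‖² ≤ MG² ∫ S'² + MG'²`
  have hR1 : Torus.IsContDiff 1 (fun y : UnitAddTorus (Fin 2) => S.onCircle (y 1) * G.onCircle (y 0)) :=
    (isSmooth_R S G).isContDiff (by simp)
  have hpt : ∀ y : UnitAddTorus (Fin 2), ‖Torus.gradient (fun y : UnitAddTorus (Fin 2) => S.onCircle (y 1) * G.onCircle (y 0)) y‖ ^ 2 =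
      (S.onCircle (y 1) * G.D.onCircle (y 0)) ^ 2 + (S.D.onCircle (y 1) * G.onCircle (y 0)) ^ 2 := by
    intro y
    rw [Literature.Analysis.FluidPDE.Torus.norm_sq_gradient_eq_sum hR1, Fin.sum_univ_two, partialDeriv_R, partialDeriv_R]
    simp
  have hsc0 : 0 ≤ Literature.Analysis.FluidPDE.Torus.scalarGradNormSq (fun y : UnitAddTorus (Fin 2) => S.onCircle (y 1) * G.onCircle (y 0)) :=
    integral_nonneg fun y => sq_nonneg _
  have hsc : Literature.Analysis.FluidPDE.Torus.scalarGradNormSq (fun y : UnitAddTorus (Fin 2) => S.onCircle (y 1) * G.onCircle (y 0)) ≤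
      MG ^ 2 * (∫ t in (0 : ℝ)..1, deriv S t ^ 2) + MG' ^ 2 := by
    unfold Literature.Analysis.FluidPDE.Torus.scalarGradNormSq
    simp_rw [hpt]
    have hcD : Continuous (fun y : UnitAddTorus (Fin 2) => S.D.onCircle (y 1)) := S.D.continuous_onCircle.comp (continuous_apply 1)
    have hint : Integrable (fun y : UnitAddTorus (Fin 2) => MG ^ 2 * (S.D.onCircle (y 1)) ^ 2 + MG' ^ 2) volume :=
      ((continuous_const.mul (hcD.pow 2)).add continuous_const).integrable_unitAddTorus
    have hcont : Continuous (fun y : UnitAddTorus (Fin 2) =>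
        (S.onCircle (y 1) * G.D.onCircle (y 0)) ^ 2 + (S.D.onCircle (y 1) * G.onCircle (y 0)) ^ 2) := by
      have h1 : Continuous (fun y : UnitAddTorus (Fin 2) => S.onCircle (y 1)) := S.continuous_onCircle.comp (continuous_apply 1)
      have h2 : Continuous (fun y : UnitAddTorus (Fin 2) => G.D.onCircle (y 0)) := G.D.continuous_onCircle.comp (continuous_apply 0)
      have h3 : Continuous (fun y : UnitAddTorus (Fin 2) => S.D.onCircle (y 1)) := S.D.continuous_onCircle.comp (continuous_apply 1)
      have h4 : Continuous (fun y : UnitAddTorus (Fin 2) => G.onCircle (y 0)) := G.continuous_onCircle.comp (continuous_apply 0)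
      exact ((h1.mul h2).pow 2).add ((h3.mul h4).pow 2)
    have hle : ∀ y : UnitAddTorus (Fin 2), (S.onCircle (y 1) * G.D.onCircle (y 0)) ^ 2 + (S.D.onCircle (y 1) * G.onCircle (y 0)) ^ 2 ≤
        MG ^ 2 * (S.D.onCircle (y 1)) ^ 2 + MG' ^ 2 := by
      intro y
      have hs := abs_le.1 (abs_onCircle_le hS (y 1))
      have hg := abs_le.1 (abs_onCircle_le hG (y 0))
      have hg' : |G.D.onCircle (y 0)| ≤ MG' := abs_onCircle_le (P := G.D) (fun t => by rw [ShearProfile.D_apply]; exact hG' t) (y 0)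
      have hg'' := abs_le.1 hg'
      have e1 : S.onCircle (y 1) ^ 2 ≤ 1 := by nlinarith
      have e2 : G.onCircle (y 0) ^ 2 ≤ MG ^ 2 := by nlinarith
      have e3 : G.D.onCircle (y 0) ^ 2 ≤ MG' ^ 2 := by nlinarith
      rw [mul_pow, mul_pow]
      nlinarith [sq_nonneg (S.onCircle (y 1)), sq_nonneg (G.onCircle (y 0)), sq_nonneg (S.D.onCircle (y 1)), sq_nonneg (G.D.onCircle (y 0))]
    calc _ ≤ ∫ y : UnitAddTorus (Fin 2), (MG ^ 2 * (S.D.onCircle (y 1)) ^ 2 + MG' ^ 2) :=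
          integral_mono hcont.integrable_unitAddTorus hint hle
      _ = MG ^ 2 * (∫ t in (0 : ℝ)..1, deriv S t ^ 2) + MG' ^ 2 := by
          have i1 : Integrable (fun y : UnitAddTorus (Fin 2) => MG ^ 2 * S.D.onCircle (y 1) ^ 2) volume :=
            (continuous_const.mul (hcD.pow 2)).integrable_unitAddTorus
          rw [MeasureTheory.integral_add i1 (integrable_const _), MeasureTheory.integral_const_mul,
            integral_onCircle_comp S.D (F := fun r : ℝ => r ^ 2) (continuous_pow 2) (1 : Fin 2)]
          simp [ShearProfile.D_apply]
  constructor
  · rw [hV]; linarith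
  · rw [hV]; nlinarith


/-- **Registered tools stub `stub_sheetDodgerFieldTools`** (crux stmt-AnomalousDissipation-13038): for all profiles `S, G` and `c`,
the field `u = (S(y₁)•(−c e₀), S(y₁)G(y₀)) ∘ π` is smooth and divergence free, `(u·∇)u = (0,0,−cS²G') ∘ π`, it has zero mean
when `S` is half-period odd, `∫‖u‖² ≤ c² + M_G²`, and `c²∫₀¹S'² ≤ gradNormSq u ≤ (c² + M_G²)∫₀¹S'² + M_G'²`. -/
theorem stub_sheetDodgerFieldTools : ∀ (S G : Literature.Analysis.FunctionSpaces.Torus.ShearProfile) (c : ℝ) (u : UnitAddTorus (Fin 3) → EuclideanSpace ℝ (Fin 3)), u = Literature.Analysis.FunctionSpaces.Torus.twoHalf (fun y : UnitAddTorus (Fin 2) => Literature.Analysis.FunctionSpaces.Torus.ShearProfile.onCircle S (y 1) • ((-c) • EuclideanSpace.single (0 : Fin 2) (1 : ℝ))) (fun y : UnitAddTorus (Fin 2) => Literature.Analysis.FunctionSpaces.Torus.ShearProfile.onCircle S (y 1) * Literature.Analysis.FunctionSpaces.Torus.ShearProfile.onCircle G (y 0)) → Literature.Analysis.FunctionSpaces.Torus.IsSmooth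 u ∧ Literature.Analysis.FunctionSpaces.Torus.IsDivFree u ∧ Literature.Analysis.FunctionSpaces.Torus.convect u u = Literature.Analysis.FunctionSpaces.Torus.twoHalf 0 (fun y : UnitAddTorus (Fin 2) => -c * Literature.Analysis.FunctionSpaces.Torus.ShearProfile.onCircle S (y 1) ^ 2 * Literature.Analysis.FunctionSpaces.Torus.ShearProfile.onCircle (Literature.Analysis.FunctionSpaces.Torus.ShearProfile.D G) (y 0)) ∧ ((∀ t : ℝ, S.toFun (t + 2⁻¹) = -S.toFun t) → Literature.Analysis.FunctionSpaces.Torus.HasZeroMean u) ∧ (∀ MG : ℝ, (∀ t : ℝ, |S.toFun t| ≤ 1) → (∀ t : ℝ, |G.toFun t| ≤ MG) → ∫ x, ‖u x‖ ^ 2 ≤ c ^ 2 + MG ^ 2) ∧ (∀ MG MG' : ℝ, (∀ t : ℝ, |S.toFun t| ≤ 1) → (∀ t : ℝ, |G.toFun t| ≤ MG) → (∀ t : ℝ, |deriv G.toFun t| ≤ MG') → c ^ 2 * intervalIntegral (fun t : ℝ => deriv S.toFun t ^ 2) 0 1 MeasureTheory.volume ≤ Literature.Analysis.FunctionSpaces.Torus.gradNormSq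 u ∧ Literature.Analysis.FunctionSpaces.Torus.gradNormSq u ≤ (c ^ 2 + MG ^ 2) * intervalIntegral (fun t : ℝ => deriv S.toFun t ^ 2) 0 1 MeasureTheory.volume + MG' ^ 2) := by
  rintro S G c u rfl
  exact ⟨isSmooth_u S G c, isDivFree_u S G c, convect_u S G c, fun hS => hasZeroMean_u S G c hS,
    fun _ hS hG => integral_norm_sq_u_le S G c hS hG, fun _ _ hS hG hG' => gradNormSq_u_bounds S G c hS hG hG'⟩

end Planar

end Summit.AnomalousDissipation.AnomalousDissipation.Theorems.SteadyStatesLoudBounded.SheetDodger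

end
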